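import Literature.Analysis.Convex.BasicOptimumSolution
import Summits.ValiantsHypothesis.ValiantsHypothesis.Theorems.KPlusLogSqLawTropicalBSparseCramer

/-!
# Route «KPlusLogSqLaw», crux `TropicalB` (stmt-ValiantsHypothesis-19771) — COMPATIBLE CLASS POTENTIALS OF HEIGHT `(2c+1)^K` FOR EVERY EXPONENT VECTOR

HONEST FRAMING.  Helper toward the registered stubs `stub_tropThin` / `stub_tropFat` of `Cruxes/TropicalB/Lines/birth.lean` (crux
`Summit.ValiantsHypothesis.ValiantsHypothesis.Theses.KPlusLogSqLaw.TropicalB`, item stmt-ValiantsHypothesis-19771, route KPlusLogSqLaw; cell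
`pub-symmetroid`, seat val-sym-trop-p1 g25, 2026-08-29; `--supports … --as helper`).  The missing half of the cell's CYCLE POTENTIAL LAW
(`…TropicalBCyclePotential`, p677819: every dominant chain whose exchange permutations have orbits `≤ c` has `n ≤ m·(U₁ − U₀)` for any class potential
`u` that is `c`-COMPATIBLE with the exponents `d`, `U₀ ≤ u ≤ U₁`) was an EXPONENT-FREE height bound: known in the kernel only for `c`-lacunary `d`
(`(c+1)^{K−1} − 1`, p677561) and for `K = 4, c = 2` (`9`, p679675).  This file proves it for EVERY `d`:

* `CompatHeight.exists_small_compatible` — **for all `K, c` and every `d : Fin K → ℕ` there is `u : Fin K → ℤ` with `0 ≤ u_l ≤ (2c+1)^K` such that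
  `Σ_l d_l δ_l ≥ 1 ⇒ Σ_l u_l δ_l ≥ 1` for every integer vector `δ` with `Σ_l |δ_l| ≤ 2c`** (difference vectors of class counts on `≤ c` columns).

PROOF (vertex of the compatibility polyhedron).  `Q = {u ∈ ℚ^K : u ≥ 0, ⟨δ, u⟩ ≥ 1 for all admissible δ with ⟨d, δ⟩ ≥ 1}` contains `d`, is pointed, and has
finitely many rows; by the tree's `Literature.Analysis.Convex.BasicOptimumSolution.exists_optimum_linearIndepOn_tight_rows` (Schrijver 1986 §8.5 (23)) it
has a point `x` with `K` linearly independent tight rows `M x = b`, `M` an INTEGER matrix with row `ℓ¹`-norms `≤ 2c` (rows `−δ` or `−e_i`), `b ∈ {−1, 0}^K`.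
Cramer: `det M • x = cramer M b`, so `u := sign(det M) • cramer M b = |det M| • x` is an integer point with `⟨δ, u⟩ = |det M|·⟨δ, x⟩ ≥ 1`, `u ≥ 0`, and
`|u_i| = |det (M with column i replaced by b)| ≤ ∏ (row ℓ¹-norms + 1) ≤ (2c+1)^K` (`…TropicalBSparseCramer.abs_cramer_le_pow` — Leibniz, no Hadamard, no `K!`).
Sharpness: for `c`-lacunary `d` every compatible `u` has height `≥ c^{K−1}` (CYCLE-POTENTIAL-g24 §1), so the base `2c+1` is right up to the constant.
[folklore: small integer realisation of a finite system of strict linear inequalities via a vertex and Cramer's rule]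
-/

set_option linter.dupNamespace false
set_option autoImplicit false

namespace Summit.ValiantsHypothesis.ValiantsHypothesis.Theorems.KPlusLogSqLaw

open scoped BigOperators
open Finset Matrix

namespace CompatHeight

/-- **Small compatible potentials.**  For every `d : Fin K → ℕ` and `c` there is an integer vector `u` with `0 ≤ u_l ≤ (2c+1)^K` such that every
integer `δ` with `Σ |δ_l| ≤ 2c` and `Σ d_l δ_l ≥ 1` has `Σ u_l δ_l ≥ 1`. [folklore] -/
theorem exists_small_compatible (K c : ℕ) (d : Fin K → ℕ) :
    ∃ u : Fin K → ℤ, (∀ l, 0 ≤ u l ∧ u l ≤ (2 * c + 1) ^ K) ∧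
      ∀ δ : Fin K → ℤ, (∑ l, |δ l|) ≤ 2 * c → 1 ≤ ∑ l, (d l : ℤ) * δ l → 1 ≤ ∑ l, u l * δ l := by
  classical
  -- `c = 0`: no admissible `δ` has `⟨d, δ⟩ ≥ 1`; `u = 0`.
  rcases Nat.eq_zero_or_pos c with hc | hc
  · subst hc
    refine ⟨fun _ => 0, fun l => ⟨le_rfl, by positivity⟩, fun δ hδ hd => ?_⟩
    exfalso
    have h0 : ∀ l, δ l = 0 := by
      intro l
      have h1 : |δ l| ≤ ∑ l, |δ l| := single_le_sum (f := fun l => |δ l|) (fun l _ => abs_nonneg _) (mem_univ l)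
      simp only [Nat.cast_zero, mul_zero] at hδ
      have h2 : |δ l| ≤ 0 := h1.trans hδ
      exact abs_nonpos_iff.mp h2
    simp [h0] at hd
  -- `K = 0`: nothing to do.
  rcases Nat.eq_zero_or_pos K with hK | hK
  · subst hK
    refine ⟨fun _ => 0, fun l => l.elim0, fun δ _ hd => ?_⟩
    simp at hd
  -- the rows: admissible difference vectors (coded by `f : Fin K → Fin (4c+1)`, `δ_l = f_l − 2c`) and the orthant rows
  obtain ⟨dec, hdec⟩ : ∃ dec : (Fin K → Fin (4 * c + 1)) → Fin K → ℤ, ∀ f l, dec f l = ((f l : ℕ) : ℤ) - 2 * c :=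
    ⟨_, fun _ _ => rfl⟩
  set S := {f : Fin K → Fin (4 * c + 1) // (∑ l, |dec f l|) ≤ 2 * c ∧ 1 ≤ ∑ l, (d l : ℤ) * dec f l} with hS
  -- integer rows and right-hand sides, indexed by `S ⊕ Fin K`
  obtain ⟨rowZ, hrowZ⟩ : ∃ rowZ : S ⊕ Fin K → Fin K → ℤ,
      (∀ s : S, rowZ (Sum.inl s) = fun l => -dec s.1 l) ∧ (∀ j : Fin K, rowZ (Sum.inr j) = fun l => if l = j then -1 else 0) :=
    ⟨fun r => match r with
      | Sum.inl s => fun l => -dec s.1 l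
      | Sum.inr j => fun l => if l = j then -1 else 0, fun _ => rfl, fun _ => rfl⟩
  obtain ⟨bZ, hbZ⟩ : ∃ bZ : S ⊕ Fin K → ℤ, (∀ s : S, bZ (Sum.inl s) = -1) ∧ (∀ j : Fin K, bZ (Sum.inr j) = 0) :=
    ⟨fun r => match r with
      | Sum.inl _ => -1
      | Sum.inr _ => 0, fun _ => rfl, fun _ => rfl⟩
  set a : S ⊕ Fin K → Fin K → ℚ := fun r l => (rowZ r l : ℚ) with ha
  set b : S ⊕ Fin K → ℚ := fun r => (bZ r : ℚ) with hb
  -- dot products of the rows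
  have ha_inl : ∀ (s : S) (x : Fin K → ℚ), a (Sum.inl s) ⬝ᵥ x = -∑ l, (dec s.1 l : ℚ) * x l := by
    intro s x
    show (∑ i, (rowZ (Sum.inl s) i : ℚ) * x i) = _
    rw [hrowZ.1 s]
    simp only [Int.cast_neg, neg_mul, sum_neg_distrib]
  have ha_inr : ∀ (j : Fin K) (x : Fin K → ℚ), a (Sum.inr j) ⬝ᵥ x = -x j := by
    intro j x
    show (∑ i, (rowZ (Sum.inr j) i : ℚ) * x i) = _
    rw [hrowZ.2 j]
    simp only [Int.cast_ite, Int.cast_neg, Int.cast_one, Int.cast_zero, ite_mul, neg_mul, one_mul, zero_mul,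
      sum_ite_eq', mem_univ, if_true]
  -- the polyhedron `{x | a r ⬝ᵥ x ≤ b r}` is pointed and contains `d`
  have hA : ∀ w : Fin K → ℚ, (∀ r, a r ⬝ᵥ w = 0) → w = 0 := by
    intro w hw
    funext j
    have h := hw (Sum.inr j)
    rw [ha_inr] at h
    simpa using h
  have hx₀ : ∀ r, a r ⬝ᵥ (fun l => (d l : ℚ)) ≤ b r := by
    rintro (s | j)
    · rw [ha_inl, hb]
      simp only [hbZ.1 s, Int.cast_neg, Int.cast_one, neg_le_neg_iff]
      have h : 1 ≤ ∑ l, dec s.1 l * (d l : ℤ) := by simpa only [mul_comm] using s.2.2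
      exact_mod_cast h
    · rw [ha_inr, hb]
      simp only [hbZ.2 j, Int.cast_zero, neg_nonpos]
      positivity
  -- a vertex: `K` linearly independent tight rows
  obtain ⟨x, hx, -, B, hBcard, hBli, hBtight⟩ :=
    Literature.Analysis.Convex.BasicOptimumSolution.exists_optimum_linearIndepOn_tight_rows a b 0 hA hx₀
      (fun y _ => by rw [zero_dotProduct, zero_dotProduct])
  rw [Fintype.card_fin] at hBcard
  have hBfin : B.Finite := Set.finite_of_ncard_pos (by omega)
  haveI : Finite B := hBfin.to_subtype
  have hcardB : Nat.card B = K := by rw [Nat.card_coe_set_eq]; exact hBcard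
  obtain ⟨e⟩ : Nonempty (Fin K ≃ B) := ⟨((Finite.equivFin B).trans (finCongr hcardB)).symm⟩
  -- the square integer system
  set Mz : Matrix (Fin K) (Fin K) ℤ := fun k l => rowZ (e k).1 l with hMz
  set M : Matrix (Fin K) (Fin K) ℚ := Mz.map (Int.cast : ℤ → ℚ) with hM
  have hMrow : ∀ k, M k = a (e k).1 := fun k => by funext l; rw [hM, ha]; rfl
  set cZ : Fin K → ℤ := fun k => bZ (e k).1 with hcZ
  -- (i) `det Mz ≠ 0`
  have hli : LinearIndependent ℚ (fun k => M k) := by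
    have h1 : LinearIndependent ℚ (fun s : B => a s) := hBli
    have h2 := h1.comp e e.injective
    convert h2 using 1
    funext k; exact hMrow k
  have hMunit : IsUnit M := linearIndependent_rows_iff_isUnit.mp hli
  have hdetM : M.det ≠ 0 := by
    have h := (isUnit_iff_isUnit_det M).mp hMunit
    exact h.ne_zero
  have hdetZ : Mz.det ≠ 0 := by
    intro h0
    apply hdetM
    rw [hM, ← SparseCramer.cast_det, h0, Int.cast_zero]
  -- (ii) tightness: `M *ᵥ x = cZ`
  have htight : M *ᵥ x = fun k => (cZ k : ℚ) := by
    funext k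
    have h := hBtight (e k).1 (e k).2
    rw [← hMrow] at h
    exact h
  -- (iii) Cramer: `cramer Mz cZ = det Mz • x` after casting
  have hcr : ∀ k, ((Mz.cramer cZ k : ℤ) : ℚ) = (Mz.det : ℚ) * x k := by
    intro k
    rw [SparseCramer.cast_cramer, ← hM]
    have h := SparseCramer.cramer_eq_det_smul_of_mulVec_eq M hdetM htight
    rw [h, Pi.smul_apply, smul_eq_mul, hM, ← SparseCramer.cast_det]
  -- the potential `u = sign(det Mz) • cramer Mz cZ = |det Mz| • x`
  set D : ℤ := Mz.det with hD
  refine ⟨fun k => Int.sign D * Mz.cramer cZ k, fun k => ?_, fun δ hδ hdδ => ?_⟩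
  · -- height
    have hu : ((Int.sign D * Mz.cramer cZ k : ℤ) : ℚ) = (|D| : ℚ) * x k := by
      push_cast
      rw [hcr k, ← mul_assoc]
      congr 1
      have : (Int.sign D : ℤ) * D = |D| := by rw [Int.sign_mul_self_eq_natAbs, Int.natCast_natAbs]
      exact_mod_cast this
    have hxk : 0 ≤ x k := by
      have h := hx (Sum.inr k)
      rw [ha_inr, hb] at h
      simp only [hbZ.2 k, Int.cast_zero, neg_nonpos] at h
      exact h
    constructor
    · have : (0 : ℚ) ≤ ((Int.sign D * Mz.cramer cZ k : ℤ) : ℚ) := by rw [hu]; positivity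
      exact_mod_cast this
    · -- `|sign D · cramer| ≤ |cramer| ≤ (2c+1)^K`
      have hrow : ∀ i, ∑ j, |Mz i j| ≤ 2 * (c : ℤ) := by
        intro i
        rcases hek : (e i).1 with s | j
        · have h := s.2.1
          calc ∑ j, |Mz i j| = ∑ l, |dec s.1 l| := by
                refine sum_congr rfl fun l _ => ?_
                rw [hMz]; simp only [hek, hrowZ.1 s, abs_neg]
            _ ≤ 2 * c := h
        · calc ∑ j', |Mz i j'| = ∑ l, |(if l = j then (-1 : ℤ) else 0)| := by
                refine sum_congr rfl fun l _ => ?_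
                rw [hMz]; simp only [hek, hrowZ.2 j]
            _ = 1 := by
                rw [Finset.sum_eq_single j]
                · simp
                · intro l _ hl; simp [hl]
                · simp
            _ ≤ 2 * c := by exact_mod_cast (show 1 ≤ 2 * c by omega)
      have hcb : ∀ i, |cZ i| ≤ 1 := by
        intro i
        rcases hek : (e i).1 with s | j
        · rw [hcZ]; simp only [hek, hbZ.1 s]; norm_num
        · rw [hcZ]; simp only [hek, hbZ.2 j]; norm_num
      have hbound := SparseCramer.abs_cramer_le_pow Mz (2 * c) hrow cZ hcb k
      rw [Fintype.card_fin] at hbound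
      have hsign : |Int.sign D| ≤ 1 := by
        rcases lt_trichotomy D 0 with h | h | h
        · rw [Int.sign_eq_neg_one_of_neg h]; norm_num
        · exact absurd h hdetZ
        · rw [Int.sign_eq_one_of_pos h]; norm_num
      calc Int.sign D * Mz.cramer cZ k ≤ |Int.sign D * Mz.cramer cZ k| := le_abs_self _
        _ = |Int.sign D| * |Mz.cramer cZ k| := abs_mul _ _
        _ ≤ 1 * (2 * (c : ℤ) + 1) ^ K := mul_le_mul hsign hbound (abs_nonneg _) zero_le_one
        _ = (2 * c + 1) ^ K := by ring
  · -- compatibility: code `δ` as a row of `S`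
    have hδl : ∀ l, |δ l| ≤ 2 * c := fun l =>
      (single_le_sum (f := fun l => |δ l|) (fun l _ => abs_nonneg _) (mem_univ l)).trans hδ
    obtain ⟨f, hf⟩ : ∃ f : Fin K → Fin (4 * c + 1), ∀ l, dec f l = δ l := by
      refine ⟨fun l => ⟨(δ l + 2 * c).toNat, ?_⟩, fun l => ?_⟩
      · have h := abs_le.mp (hδl l)
        have : (δ l + 2 * c).toNat ≤ 4 * c := by
          have h2 : δ l + 2 * c ≤ 4 * c := by linarith
          exact_mod_cast (Int.toNat_le.mpr (by exact_mod_cast h2) : (δ l + 2 * c).toNat ≤ 4 * c)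
        omega
      · have h := abs_le.mp (hδl l)
        rw [hdec]
        simp only
        rw [Int.toNat_of_nonneg (by linarith)]
        ring
    have hfS : (∑ l, |dec f l|) ≤ 2 * c ∧ 1 ≤ ∑ l, (d l : ℤ) * dec f l := by
      constructor
      · simpa only [hf] using hδ
      · simpa only [hf] using hdδ
    set s : S := ⟨f, hfS⟩ with hs
    -- feasibility of `x` at the row of `s`: `⟨δ, x⟩ ≥ 1`
    have hxs := hx (Sum.inl s)
    rw [ha_inl, hb] at hxs
    simp only [hbZ.1 s, Int.cast_neg, Int.cast_one, neg_le_neg_iff] at hxs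
    have hxs' : (1 : ℚ) ≤ ∑ l, (δ l : ℚ) * x l := by
      simpa only [hs, hf] using hxs
    -- `⟨δ, u⟩ = |D| · ⟨δ, x⟩ ≥ |D| ≥ 1`
    have hD1 : (1 : ℚ) ≤ (|D| : ℚ) := by
      have : (1 : ℤ) ≤ |D| := Int.one_le_abs hdetZ
      exact_mod_cast this
    have hsum : ((∑ l, (Int.sign D * Mz.cramer cZ l) * δ l : ℤ) : ℚ) = (|D| : ℚ) * ∑ l, (δ l : ℚ) * x l := by
      push_cast
      rw [mul_sum]
      refine sum_congr rfl fun l _ => ?_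
      rw [hcr l]
      have : ((Int.sign D : ℤ) : ℚ) * (D : ℚ) = (|D| : ℚ) := by
        have h : (Int.sign D : ℤ) * D = |D| := by rw [Int.sign_mul_self_eq_natAbs, Int.natCast_natAbs]
        exact_mod_cast h
      rw [← this]; ring
    have : (1 : ℚ) ≤ ((∑ l, (Int.sign D * Mz.cramer cZ l) * δ l : ℤ) : ℚ) := by
      rw [hsum]; nlinarith
    exact_mod_cast this

end CompatHeight

end Summit.ValiantsHypothesis.ValiantsHypothesis.Theorems.KPlusLogSqLaw
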